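import Summits.BirchSwinnertonDyer.Rank1Residual.GaloisImage.KolyvaginLedgerAlgebra
import Summits.BirchSwinnertonDyer.Rank1Residual.GaloisImage.PropagatedStructureKummer
import Summits.BirchSwinnertonDyer.Rank1Residual.GaloisImage.PropagatedStructureUnramified
import Literature.NumberTheory.EllipticCurves.SemistableModPImageAbelianProofs
import Literature.NumberTheory.GaloisRepresentations.LocalGlobalCohomologyDualityProofs
import Literature.NumberTheory.GaloisRepresentations.ContinuousH1OrderTwo
import HarnessLib

/-!
# The DEEP-LEVEL LEDGER of the (a′) lower bound at an additive prime: from the propagated Selmer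
# group at one deep finite level to `p^β ∣ #Sel_{p^K}(E/ℚ)` (team n1011, ROUTE-1 §20.4 (C20),
# sub-target R1-23, skeleton `cells/n1011/skel/T-R1-23.md` steps S5–S6; p18)

HONEST FRAMING (cell `b2b-bsdres`, run/shared/lean/b2b/bsd-rank1-residual/, verbatim in every
file): the goal of the cell is to DELETE the COMBINATION-SHAPED residual classes of the
Birch–Swinnerton-Dyer formula for ALL analytic-rank `≤ 1` elliptic curves over `ℚ` — "full BSD
formula for every rank `≤ 1` curve in class `C`" assembled STRICTLY from published theorems — so
that the rank-`≤ 1` remainder becomes exactly the CONSTRUCTION-SHAPED classes, which are TYPED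
(missing-input `Prop`s), NOT attempted. This is not "finishing BSD". Team n1011 (N10/N11, the
additive block `X4 ∧ p = 3`): research route; TOOL theorems (Selmer-group bookkeeping at ONE finite
level), no class theorem, nothing booked, no mark changed, no fact.

## What and why

R1-23's (a′) assembly proves a LOWER bound on `#Ш(E)[p^∞]` from a Kurihara-number certificate.  The
`L`-value enters through Kato's class only at a DEEP level `K = k + 1` (skeleton §0: at the
certificate level it is invisible), where the cell's typed dictionary (p09,
`KatoKuriharaDictionaryThreeAt`) supplies a functional `Λ` on `H¹(ℚ_p, E[p^K])` that is onto
`ℤ/p^K` on the propagated condition `𝓕_can(v_p)` with kernel the Kummer condition.  This file is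
the bookkeeping at that level, for a general prime `p ≠ 2` and depth `k`, with every Galois-
cohomological input a tree THEOREM and every global input an explicit HYPOTHESIS in the shape its
owner lands it (the Poitou–Tate count `#H¹_{𝓕_can} = p^K · #N_∅` — p13's `card_selmerGroup_pair`
read through `Λ`; Sakamoto's Thm. 4.4 (2) at the empty level in p11's ORDER form, R1-22):

* `DeepLedger.apply_localization_eq_zero_iff_mem_kummer` — for `x ∈ H¹_{𝓕_can}(ℚ, E[p^K])`:
  `Λ(loc_{v_p} x) = 0 ↔ x ∈ H¹_𝓚(ℚ, E[p^K]) = Sel_{p^K}` (at `v ≠ v_p` finite `𝓕_can = 𝓚` is p05's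
  `propagatedSelmerStructure_inr_eq_kummerSelmerStructure`; at infinite places `H¹ = 0`, `p` odd);
* `DeepLedger.exists_pow_mem_and_card` — a subgroup of `ℤ/p^K` is `(p^c)` of order `p^{K−c}`;
* `DeepLedger.natCard_kummer_eq` — `#H¹_𝓚 = p^c · #N_∅` where `(p^c)` is the image of `Λ ∘ loc`;
* **`DeepLedger.pow_dvd_natCard_selmerGroup_kummer`** — if the generator's bottom class `g_∅` has
  `Λ(loc g_∅) = p^β · unit`, `H¹_𝓚` is killed by `p^X`, and `X + β ≤ K` (the level is DEEP), then
  `p^β ∣ #H¹_𝓚(ℚ, E[p^K])` (ledger algebra `Ledger.pow_nsmul_eq_zero_of_ledger` +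
  `Ledger.pow_dvd_of_addOrderOf_mul_eq`).

References: B. Mazur, K. Rubin, Mem. AMS 799 (2004) Thm. 2.3.4, Prop. 2.3.5 [MazurRubin2004];
R. Sakamoto, JTNB 36 (2024) Thm. 4.4 (2) [Sakamoto2024]; C.-H. Kim, AJM 148 (2026) Prop. 3.12,
Thm. 3.13 [Kim2022StructureSelmer]; cells/n1011/skel/T-R1-23.md.
-/

noncomputable section

open scoped Classical NumberField
open NumberField IsDedekindDomain WeierstrassCurve
  Literature.NumberTheory.EllipticCurves
  Literature.NumberTheory.GaloisRepresentations
  Literature.NumberTheory.GaloisRepresentations.DiscreteGaloisModule Literature.NumberTheory.GaloisCohomology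

namespace Summit.BirchSwinnertonDyer.Rank1Residual.GaloisImage

namespace DeepLedger

/-! ## §A Subgroups of `ℤ/p^K` -/

/-- **Every subgroup of `ℤ/p^K` is `(p^c)` for a unique `c ≤ K`, of order `p^{K−c}`**: there is
`c ≤ K` with `p^c ∈ H`, `H ⊆ (p^c)`, `#H = p^{K−c}`. [folklore] -/
theorem exists_pow_mem_and_card {p K : ℕ} [hp : Fact p.Prime] (H : AddSubgroup (ZMod (p ^ K))) :
    ∃ c ≤ K, ((p ^ c : ℕ) : ZMod (p ^ K)) ∈ H ∧
      (∀ x ∈ H, ((p ^ c : ℕ) : ZMod (p ^ K)) ∣ x) ∧ Nat.card H = p ^ (K - c) := by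
  haveI : NeZero (p ^ K) := ⟨pow_ne_zero K hp.out.ne_zero⟩
  -- `#H = p^m`, `m ≤ K`
  have hdvd : Nat.card H ∣ p ^ K := by
    have h := AddSubgroup.card_addSubgroup_dvd_card H
    rwa [Nat.card_zmod] at h
  obtain ⟨m, hmK, hm⟩ := (Nat.dvd_prime_pow hp.out).1 hdvd
  refine ⟨K - m, Nat.sub_le K m, ?_, ?_, by rw [hm]; congr 1; omega⟩
  · -- `H = (p^{K−m})`, comparing orders inside `(p^{K−m})`
    have hle : H ≤ AddSubgroup.zmultiples (((p ^ (K - m) : ℕ) : ZMod (p ^ K))) := by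
      intro x hx
      have hx0 : p ^ m • x = 0 := by
        have h1 := addOrderOf_dvd_natCard (⟨x, hx⟩ : H)
        rw [hm] at h1
        have h2 := addOrderOf_dvd_iff_nsmul_eq_zero.1 h1
        simpa using congrArg Subtype.val h2
      rw [nsmul_eq_mul] at hx0
      obtain ⟨r, hr⟩ := Ledger.pow_dvd_of_pow_mul_eq_zero (p := p) hmK x hx0
      rw [AddSubgroup.mem_zmultiples_iff]
      exact ⟨(r.val : ℤ), by rw [hr, mul_comm]; simp [zsmul_eq_mul]⟩
    have hcard : Nat.card (AddSubgroup.zmultiples (((p ^ (K - m) : ℕ) : ZMod (p ^ K)))) =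
        Nat.card H := by
      rw [Nat.card_zmultiples, ZMod.addOrderOf_coe _ (NeZero.ne _), hm,
        Nat.gcd_eq_right (Nat.pow_dvd_pow p (Nat.sub_le K m)), Nat.pow_div (Nat.sub_le K m) hp.out.pos]
      congr 1
      omega
    have heq : H = AddSubgroup.zmultiples (((p ^ (K - m) : ℕ) : ZMod (p ^ K))) :=
      AddSubgroup.eq_of_le_of_card_ge hle hcard.le
    rw [heq]
    exact AddSubgroup.mem_zmultiples _
  · intro x hx
    have hx0 : p ^ m • x = 0 := by
      have h1 := addOrderOf_dvd_natCard (⟨x, hx⟩ : H)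
      rw [hm] at h1
      have h2 := addOrderOf_dvd_iff_nsmul_eq_zero.1 h1
      simpa using congrArg Subtype.val h2
    rw [nsmul_eq_mul] at hx0
    exact Ledger.pow_dvd_of_pow_mul_eq_zero (p := p) hmK x hx0

/-! ## §B The kernel of `Λ ∘ loc_{v_p}` on the propagated Selmer group is the `p^K`-Selmer group -/

section Kernel

variable (W : WeierstrassCurve ℚ) [W.IsElliptic] (p : ℕ) [hp : Fact p.Prime] (k : ℕ)

/-- `p^k · p` is odd for an odd prime `p`. [folklore] -/
theorem odd_pow_mul (hp2 : p ≠ 2) : Odd ((p : ℤ) ^ k * (p : ℤ)) := by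
  have hodd : Odd (p : ℤ) := (hp.out.odd_of_ne_two hp2).natCast
  exact (hodd.pow).mul hodd

omit [W.IsElliptic] in
/-- At an infinite place `H¹(ℚ_w, E[p^{k+1}]) = 0` (`p` odd), so every local condition holds there.
[cite: MilneADT2006, I Rem. 3.7] -/
theorem localization_inl_eq_zero (hp2 : p ≠ 2) (w : InfinitePlace ℚ)
    (x : galoisCohomology (W.torsionGaloisModule ((p : ℤ) ^ k * (p : ℤ))) 1) :
    galoisCohomology.localization (W.torsionGaloisModule ((p : ℤ) ^ k * (p : ℤ))) (Sum.inl w) 1 x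
      = 0 := by
  set y := galoisCohomology.localization (W.torsionGaloisModule ((p : ℤ) ^ k * (p : ℤ)))
    (Sum.inl w) 1 x
  have hn : (((p : ℤ) ^ k * (p : ℤ)).natAbs) • y = 0 :=
    galoisCohomology.nsmul_eq_zero_of_forall _ (fun T => W.natAbs_nsmul_geomTorsion T) y
  exact eq_zero_of_odd_nsmul_eq_zero_infinitePlace w _
    (Int.natAbs_odd.mpr (odd_pow_mul p k hp2)) y hn

/-- **`ker(Λ ∘ loc_{v_p}) ∩ H¹_{𝓕_can} = H¹_𝓚 = Sel_{p^{k+1}}(E/ℚ)`**: for `x` in the propagated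
Selmer group, `Λ(loc_{v_p} x) = 0` iff `x` lies in the Kummer (classical) Selmer group — at `v_p`
by the kernel clause of the dictionary, at finite `v ≠ v_p` because `𝓕_can,v = 𝓚_v`
(`propagatedSelmerStructure_inr_eq_kummerSelmerStructure`), at infinite places because `H¹ = 0`.
[cite: Kim2022StructureSelmer, Prop. 3.12 and §3.4.1 (arXiv p. 17)] -/
theorem apply_localization_eq_zero_iff_mem_kummer (hp2 : p ≠ 2) {v₀ : HeightOneSpectrum (𝓞 ℚ)}
    (hv₀ : ((p : ℕ) : 𝓞 ℚ) ∈ v₀.asIdeal)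
    (Λ : galoisCohomology ((W.torsionGaloisModule ((p : ℤ) ^ k * (p : ℤ))).toLocal (Sum.inr v₀)) 1
      →+ ZMod (p ^ (k + 1)))
    (hker : ∀ x ∈ propagatedSelmerStructure W p k (Sum.inr v₀),
      Λ x = 0 ↔ x ∈ W.kummerSelmerStructure ((p : ℤ) ^ k * (p : ℤ)) (Sum.inr v₀))
    {x : galoisCohomology (W.torsionGaloisModule ((p : ℤ) ^ k * (p : ℤ))) 1}
    (hx : x ∈ (propagatedSelmerStructure W p k).selmerGroup) :
    Λ (galoisCohomology.localization _ (Sum.inr v₀) 1 x) = 0 ↔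
      x ∈ (W.kummerSelmerStructure ((p : ℤ) ^ k * (p : ℤ))).selmerGroup := by
  rw [SelmerStructure.mem_selmerGroup_iff] at hx ⊢
  constructor
  · intro h v
    rcases v with w | v
    · rw [localization_inl_eq_zero W p k hp2 w x]
      exact zero_mem _
    · by_cases hv : v = v₀
      · subst hv
        exact (hker _ (hx _)).1 h
      · have hpv : ((p : ℕ) : 𝓞 ℚ) ∉ v.asIdeal := fun h' =>
          hv (heightOneSpectrum_eq_of_natCast_mem hp.out h' hv₀)
        rw [← propagatedSelmerStructure_inr_eq_kummerSelmerStructure W p k hpv]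
        exact hx _
  · intro h
    exact (hker _ (hx _)).2 (h _)

/-- The Kummer Selmer group lies in the propagated one (Kummer condition `≤ 𝓕_can` everywhere,
p13 `kummerSelmerStructure_le_propagatedSelmerStructure`). [cite: Rubin2011, §3.1 (p. 29)] -/
theorem selmerGroup_kummer_le :
    (W.kummerSelmerStructure ((p : ℤ) ^ k * (p : ℤ))).selmerGroup ≤
      (propagatedSelmerStructure W p k).selmerGroup := by
  intro x hx
  rw [SelmerStructure.mem_selmerGroup_iff] at hx ⊢
  exact fun v => kummerSelmerStructure_le_propagatedSelmerStructure W p v k (hx v)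

end Kernel

/-! ## §C The count `#H¹_𝓚 = p^c · #N_∅` through `Λ` -/

section Count

variable (W : WeierstrassCurve ℚ) [W.IsElliptic] (p : ℕ) [hp : Fact p.Prime] (k : ℕ)

omit [W.IsElliptic] hp in
/-- `p^{k+1}` kills `H¹(ℚ, E[p^{k+1}])`. [folklore] -/
theorem pow_succ_nsmul_galoisCohomology_eq_zero
    (x : galoisCohomology (W.torsionGaloisModule ((p : ℤ) ^ k * (p : ℤ))) 1) :
    p ^ (k + 1) • x = 0 :=
  galoisCohomology.nsmul_eq_zero_of_forall _ (fun T => by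
    have h := W.natAbs_nsmul_geomTorsion T
    rwa [show ((p : ℤ) ^ k * (p : ℤ)).natAbs = p ^ (k + 1) by
      rw [Int.natAbs_mul, Int.natAbs_pow, Int.natAbs_natCast, pow_succ]] at h) x

/-- **`#H¹_𝓚(ℚ, E[p^{k+1}]) = p^c · N`**, where `(p^c)` is the image of `Λ ∘ loc_{v_p}` on
`H¹_{𝓕_can}` (attained at some `x`), GIVEN the Poitou–Tate count `#H¹_{𝓕_can} = p^{k+1} · N`
(`N = #H¹_{𝓕_can^*}(ℚ, E[p^{k+1}]^∨(1))`; p13 `card_selmerGroup_pair` + hKSD + the index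
`[𝓕_can(v_p) : 𝓚(v_p)] = p^{k+1}`, taken here as a hypothesis). [cite: MazurRubin2004, Prop. 2.3.5] -/
theorem natCard_kummer_eq (hp2 : p ≠ 2) {v₀ : HeightOneSpectrum (𝓞 ℚ)}
    (hv₀ : ((p : ℕ) : 𝓞 ℚ) ∈ v₀.asIdeal)
    (Λ : galoisCohomology ((W.torsionGaloisModule ((p : ℤ) ^ k * (p : ℤ))).toLocal (Sum.inr v₀)) 1
      →+ ZMod (p ^ (k + 1)))
    (hker : ∀ x ∈ propagatedSelmerStructure W p k (Sum.inr v₀),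
      Λ x = 0 ↔ x ∈ W.kummerSelmerStructure ((p : ℤ) ^ k * (p : ℤ)) (Sum.inr v₀))
    {N : ℕ} (hcount : Nat.card (propagatedSelmerStructure W p k).selmerGroup = p ^ (k + 1) * N) :
    ∃ c ≤ k + 1, (∃ x ∈ (propagatedSelmerStructure W p k).selmerGroup,
        Λ (galoisCohomology.localization _ (Sum.inr v₀) 1 x) = ((p ^ c : ℕ) : ZMod (p ^ (k + 1)))) ∧
      Nat.card (W.kummerSelmerStructure ((p : ℤ) ^ k * (p : ℤ))).selmerGroup = p ^ c * N := by
  -- `Λ' = Λ ∘ loc ∘ incl : H¹_𝓕 → ℤ/p^{k+1}`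
  let Λ' : (propagatedSelmerStructure W p k).selmerGroup →+ ZMod (p ^ (k + 1)) :=
    (Λ.comp (galoisCohomology.localization (W.torsionGaloisModule ((p : ℤ) ^ k * (p : ℤ)))
      (Sum.inr v₀) 1)).comp (propagatedSelmerStructure W p k).selmerGroup.subtype
  have hΛ'_apply : ∀ x : (propagatedSelmerStructure W p k).selmerGroup,
      Λ' x = Λ (galoisCohomology.localization _ (Sum.inr v₀) 1 (x : galoisCohomology _ 1)) :=
    fun x => rfl
  -- the image is `(p^c)` of order `p^{k+1−c}`
  obtain ⟨c, hcK, hmem, -, hcardI⟩ := exists_pow_mem_and_card (p := p) Λ'.range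
  -- the kernel is `H¹_𝓚`
  have hkerEq : Λ'.ker = (W.kummerSelmerStructure ((p : ℤ) ^ k * (p : ℤ))).selmerGroup.addSubgroupOf
      (propagatedSelmerStructure W p k).selmerGroup := by
    ext x
    rw [AddMonoidHom.mem_ker, AddSubgroup.mem_addSubgroupOf, hΛ'_apply]
    exact apply_localization_eq_zero_iff_mem_kummer W p k hp2 hv₀ Λ hker x.2
  have hkerCard : Nat.card Λ'.ker =
      Nat.card (W.kummerSelmerStructure ((p : ℤ) ^ k * (p : ℤ))).selmerGroup := by
    rw [hkerEq]
    exact Nat.card_congr (AddSubgroup.addSubgroupOfEquivOfLe (selmerGroup_kummer_le W p k)).toEquiv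
  -- `#H¹_𝓕 = #ker · #range`
  have hsplit : Nat.card (propagatedSelmerStructure W p k).selmerGroup =
      Nat.card Λ'.ker * Nat.card Λ'.range := by
    rw [AddSubgroup.card_eq_card_quotient_mul_card_addSubgroup Λ'.ker, mul_comm,
      Nat.card_congr (QuotientAddGroup.quotientKerEquivRange Λ').toEquiv]
  refine ⟨c, hcK, ?_, ?_⟩
  · obtain ⟨x, hx⟩ := hmem
    exact ⟨x.1, x.2, by rw [← hΛ'_apply]; exact hx⟩
  · rw [hkerCard, hcardI, hcount] at hsplit
    have hpow : p ^ (k + 1) = p ^ c * p ^ (k + 1 - c) := by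
      rw [← pow_add, Nat.add_sub_cancel' hcK]
    rw [hpow, mul_assoc, mul_comm (p ^ (k + 1 - c)) N, ← mul_assoc] at hsplit
    exact (Nat.eq_of_mul_eq_mul_right (pow_pos hp.out.pos _) hsplit).symm

end Count

/-! ## §D The deep ledger: `p^β ∣ #Sel_{p^{k+1}}(E/ℚ)` -/

section Main

variable (W : WeierstrassCurve ℚ) [W.IsElliptic] (p : ℕ) [hp : Fact p.Prime] (k : ℕ)

/-- **The deep-level ledger (skeleton step S5).**  At the deep level `K = k + 1`, with `Λ` as in the
dictionary (kernel clause `hker`), the Poitou–Tate count `#H¹_{𝓕_can} = p^K · N` (`N = p^l`),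
a class `g ∈ H¹_{𝓕_can}` satisfying Sakamoto's Thm. 4.4 (2) at the empty level in ORDER form
(R1-22: `N ∣ p^K → addOrderOf g · N = p^K`, and `p^K ∣ N → g = 0`), whose local value is
`Λ(loc g) = p^β · (unit)` with `β ≤ K`, and the Selmer group `H¹_𝓚 = Sel_{p^K}` killed by `p^X`
with `X + β ≤ K`: **`p^β ∣ #H¹_𝓚(ℚ, E[p^K])`**.
[cite: Sakamoto2024, Thm. 4.4 (2) (p. 926)] [cite: MazurRubin2004, Thm. 2.3.4 and Prop. 2.3.5] -/
theorem pow_dvd_natCard_selmerGroup_kummer (hp2 : p ≠ 2) {v₀ : HeightOneSpectrum (𝓞 ℚ)}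
    (hv₀ : ((p : ℕ) : 𝓞 ℚ) ∈ v₀.asIdeal)
    (Λ : galoisCohomology ((W.torsionGaloisModule ((p : ℤ) ^ k * (p : ℤ))).toLocal (Sum.inr v₀)) 1
      →+ ZMod (p ^ (k + 1)))
    (hker : ∀ x ∈ propagatedSelmerStructure W p k (Sum.inr v₀),
      Λ x = 0 ↔ x ∈ W.kummerSelmerStructure ((p : ℤ) ^ k * (p : ℤ)) (Sum.inr v₀))
    {N : ℕ} (hNp : ∃ l, N = p ^ l)
    (hcount : Nat.card (propagatedSelmerStructure W p k).selmerGroup = p ^ (k + 1) * N)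
    {g : galoisCohomology (W.torsionGaloisModule ((p : ℤ) ^ k * (p : ℤ))) 1}
    (hg : g ∈ (propagatedSelmerStructure W p k).selmerGroup)
    (hR22 : (N ∣ p ^ (k + 1) → addOrderOf g * N = p ^ (k + 1)) ∧ (p ^ (k + 1) ∣ N → g = 0))
    {β : ℕ} (hβK : β ≤ k + 1) (w : (ZMod (p ^ (k + 1)))ˣ)
    (hgβ : Λ (galoisCohomology.localization _ (Sum.inr v₀) 1 g) =
      ((p ^ β : ℕ) : ZMod (p ^ (k + 1))) * (w : ZMod (p ^ (k + 1))))
    {X : ℕ} (hX : ∀ s ∈ (W.kummerSelmerStructure ((p : ℤ) ^ k * (p : ℤ))).selmerGroup, p ^ X • s = 0)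
    (hK : X + β ≤ k + 1) :
    p ^ β ∣ Nat.card (W.kummerSelmerStructure ((p : ℤ) ^ k * (p : ℤ))).selmerGroup := by
  haveI : NeZero (p ^ (k + 1)) := ⟨pow_ne_zero _ hp.out.ne_zero⟩
  obtain ⟨c, hcK, ⟨x, hx, hxc⟩, hcard⟩ := natCard_kummer_eq W p k hp2 hv₀ Λ hker hcount
  obtain ⟨l, rfl⟩ := hNp
  rcases le_or_gt l (k + 1) with hl | hl
  · -- `N = p^l ∣ p^K`: the order form gives `addOrderOf g · N = p^K`
    have hord : addOrderOf g * p ^ l = p ^ (k + 1) := hR22.1 (Nat.pow_dvd_pow p hl)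
    rcases le_or_gt c β with hcβ | hβc
    · -- the ledger lemma on the group `H¹_𝓕`
      let Λ' : (propagatedSelmerStructure W p k).selmerGroup →+ ZMod (p ^ (k + 1)) :=
        (Λ.comp (galoisCohomology.localization (W.torsionGaloisModule ((p : ℤ) ^ k * (p : ℤ)))
          (Sum.inr v₀) 1)).comp (propagatedSelmerStructure W p k).selmerGroup.subtype
      have hΛ'_apply : ∀ y : (propagatedSelmerStructure W p k).selmerGroup,
          Λ' y = Λ (galoisCohomology.localization _ (Sum.inr v₀) 1 (y : galoisCohomology _ 1)) :=
        fun y => rfl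
      have hX' : ∀ s : (propagatedSelmerStructure W p k).selmerGroup, Λ' s = 0 → p ^ X • s = 0 := by
        intro s hs
        rw [hΛ'_apply] at hs
        have hs𝓚 := (apply_localization_eq_zero_iff_mem_kummer W p k hp2 hv₀ Λ hker s.2).1 hs
        exact Subtype.ext (by simpa using hX s.1 hs𝓚)
      have hxK : p ^ (k + 1) • (⟨x, hx⟩ : (propagatedSelmerStructure W p k).selmerGroup) = 0 :=
        Subtype.ext (by simpa using pow_succ_nsmul_galoisCohomology_eq_zero W p k x)
      have hkill := Ledger.pow_nsmul_eq_zero_of_ledger (p := p) Λ' hX' ⟨x, hx⟩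
        (by rw [hΛ'_apply]; exact hxc) hxK ⟨g, hg⟩ (w : ZMod (p ^ (k + 1))).val
        (by rw [hΛ'_apply, Nat.cast_mul, ZMod.natCast_zmod_val]; exact hgβ) hcβ (by omega)
      have hkill' : p ^ (k + 1 + c - β) • g = 0 := by
        simpa using congrArg Subtype.val hkill
      have hdvd := Ledger.pow_dvd_of_addOrderOf_mul_eq (p := p) g hord hkill' (by omega)
      rw [hcard]
      exact Ledger.pow_dvd_card_of_ledger (p := p) hdvd hcβ rfl
    · -- `β < c`: then `p^β ∣ p^c ∣ #𝓚`
      rw [hcard]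
      exact (Nat.pow_dvd_pow p hβc.le).mul_right _
  · -- `p^K ∣ N`: then `p^β ∣ p^K ∣ N ∣ #𝓚`
    rw [hcard]
    exact ((Nat.pow_dvd_pow p hβK).trans (Nat.pow_dvd_pow p hl.le)).trans (Dvd.intro_left _ rfl)

end Main

end DeepLedger

end Summit.BirchSwinnertonDyer.Rank1Residual.GaloisImage

end
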